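import Mathlib
import Summits.MatrixMultiplication.MatrixMultiplication.Theses.ThinBlockAlpha
import Summits.MatrixMultiplication.MatrixMultiplication.Theses.RectangularAlpha
import Summits.MatrixMultiplication.MatrixMultiplication.Theorems.ThinBlockAlphaRectangularThmBChartSTPP
import Summits.MatrixMultiplication.MatrixMultiplication.Theorems.ThinBlockAlphaBoundedExponentTwoSevenths
import Summits.MatrixMultiplication.MatrixMultiplication.Theorems.RectangularAlphaThinDesignsCertify
import Literature.Computability.AlgebraicComplexity.LaserMethodTypeCount

/-!
# Line `thin_third_rung` — the NEXT RUNG of the `a`-ladder of crux `ThinBlockAlpha.ThinPackings`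
# (stmt-MatrixMultiplication-10595; forward generator G4 `ladder-down`, unit fwd-ladder-MatrixMultiplication-50)

The crux `ThinPackings` is, in its own language, the conjunction over the shape exponent `a ∈ [0,1)` of the
columns `ThinRung a := ∀ η > 0, ThinSlice a η` (thin abelian STPP families of blocks `⟨N, M, N⟩`, `M ≥ N^a`,
packed up to slack `N^η`): `thinPackings_iff_forall_thinRung` (by `Iff.rfl`).  `ThinRung` is antitone in `a`
(`thinRung_anti`).

* FLOOR (highest proved rung): `ThinRung (2/7)` — `thinRung_twoSevenths`, read off the tree theorem
  `Theorems.boundedExponentTwoSevenths_proof` (item stmt-15152, null-offset CKSU chart over `ℤ/9` + hashing); hence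
  `ThinRung a` for every `a ≤ 2/7` (`thinRung_of_le_twoSevenths`).
* NEXT RUNG (this line's target): `ThinThird := ThinRung (1/3)`.  ONE parameter moved: `a : 2/7 → 1/3` — the next
  notch of both design engines (null-offset chart `a(ℓ) = 2/(ℓ-2)` at `ℓ = 8`; CKSU USP words `a = 2/(m-1)` at `m = 7`)
  and the first column whose payoff lies beyond the laser-method record: `ThinThird → ω_ℂ(1, 1/3, 1) = 2`
  (`omegaRect_third_of_thinThird`) `→ DAlphaOneThird` (stmt-0606; `α_ℂ ≥ 1/3 > 0.321334`).
* ON-PATH: `ThinPackings → ThinThird` (`thinThird_of_thinPackings`); `BoundedExponentThird → ThinThird`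
  (`thinThird_of_boundedExponentThird`, item stmt-10596 is the exponent-bounded strengthening of this rung).
* LOCATED STOP of the floor proof at `a = 1/3`: the null-offset chart over `ℤ/8` at composition `(3/8,1/8,3/8,1/8)` needs
  hashing rate `log₂ 8 - (3/4) log₂ 6 = 1.0613` bits per coordinate, but its two binary profile legs cap the tree's hashing
  theorem (`exists_free_diagonal_jointType_card`: rate `min_m H(P_m) - Γ_S(P)`) at `1` bit — deficit `0.0613`.

SKELETON (registered stubs, `sorry` only inside `stub_*`):
* `stub_trappedSeedThird : TrappedTightSeed (1/3)` — LOAD-BEARING: one finite TRAPPED TIGHT SEED at shape `1/3`, in the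
  certificate format of `Theorems/RectangularThmB/Negative/NullChart.lean` + `NullChartEntropy.lean` generalised to any
  finite abelian base `H₀`, any alphabet, any profile maps: per-symbol TPP, injective profiles onto a support `S`, a Farkas
  functional trapping solvable patterns onto `S`, tight bounded injective labels, and a base type `Q` on `S` whose block is
  `⟨NA, NB, NA⟩` with `NA^{1/3} ≤ NB` and `|H₀|^{|Q|} ≤ NA² · 2^{|Q| (min_m H(P_m) - Γ_S(P))}` (entropy tightness).
* `stub_trappedSeedCompiler : ∀ a ≥ 0, TrappedTightSeed a → ThinRung a` — the floor's pipeline made generic: method of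
  types + Le Gall A.2 free diagonal (`exists_free_diagonal_jointType_card`) + Farkas trapping ⇒ `IsLocalChartUSP` + CKSU
  Thm 37 (`stub_chartSTPP`, proved) + growth (subexponential hashing loss `< NA^{mη}`).  Known method, unformalised (size L).
* `ThinThird_of : stub_trappedSeedCompiler → stub_trappedSeedThird → ThinThird` (kernel-checked composition).

Sources: Cohn–Kleinberg–Szegedy–Umans, FOCS 2005, arXiv:math/0511460 §6 (Def. 36, Thm. 37, Thm 5.5); Blasiak–Church–Cohn–
Grochow–Naslund–Sawin–Umans, Discrete Analysis 2017:3, arXiv:1605.06702 (Thm B); Le Gall, arXiv:1401.7714 (Lemma A.2);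
tree: `Theorems/ThinBlockAlphaBoundedExponentTwoSevenths.lean`, `Theorems/RectangularAlphaThinDesignsCertify.lean`,
`Cruxes/ThinPackings/STRATEGY-CENSUS.md` (gen 6), `Cruxes/ThinPackings/StrategyCensusSketch.lean` (`FixedSeedCharts`).
-/

set_option linter.dupNamespace false

noncomputable section

open Finset

namespace Summit.MatrixMultiplication.MatrixMultiplication.Cruxes.ThinPackings.ThinThirdRung

open Literature.Computability.AlgebraicComplexity
open Summit.MatrixMultiplication.MatrixMultiplication.Theorems
open Summit.MatrixMultiplication.MatrixMultiplication.Theses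
open Summit.MatrixMultiplication.MatrixMultiplication.Theses.ThinBlockAlpha

/-! ## The gradation of the crux in its own language -/

/-- The `(a, η)` slice of `ThinPackings`: an abelian STPP family of `L` blocks `⟨N, M, N⟩`, `N ≥ 2`, `M ≥ N^a`,
in a finite abelian group `H` with `|H| ≤ L · N^{2+η}` (the literal `∃`-body of the crux). -/
def ThinSlice (a η : ℝ) : Prop :=
  ∃ (H : Type) (_ : AddCommGroup H) (_ : Fintype H) (L N M : ℕ) (A B C : Fin L → Finset H),
    IsSTPP A B C ∧ (∀ i, (A i).card = N ∧ (B i).card = M ∧ (C i).card = N) ∧ 2 ≤ N ∧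
    (N : ℝ) ^ a ≤ M ∧ (Fintype.card H : ℝ) ≤ L * (N : ℝ) ^ (2 + η)

/-- The `a`-column (rung) of `ThinPackings`: thin designs of shape exponent `a` for EVERY slack `η > 0`. -/
def ThinRung (a : ℝ) : Prop := ∀ η : ℝ, 0 < η → ThinSlice a η

/-- **The next rung**: the `a = 1/3` column of `ThinPackings`. -/
def ThinThird : Prop := ThinRung (1 / 3 : ℝ)

/-- The crux is the conjunction of its columns over `a ∈ [0, 1)` (definitional). -/
theorem thinPackings_iff_forall_thinRung : ThinPackings ↔ ∀ a : ℝ, 0 ≤ a → a < 1 → ThinRung a :=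
  Iff.rfl

/-- ON-PATH: the crux gives the rung (`a := 1/3`). -/
theorem thinThird_of_thinPackings (h : ThinPackings) : ThinThird := h (1 / 3) (by norm_num) (by norm_num)

/-- Slices are antitone in the shape exponent (`N ≥ 2`, so `N^a ≤ N^b` for `a ≤ b`). -/
theorem thinSlice_anti {a b η : ℝ} (hab : a ≤ b) (h : ThinSlice b η) : ThinSlice a η := by
  obtain ⟨H, i1, i2, L, N, M, A, B, C, hS, hc, hN, hM, hP⟩ := h
  refine ⟨H, i1, i2, L, N, M, A, B, C, hS, hc, hN, le_trans ?_ hM, hP⟩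
  have hN1 : (1 : ℝ) ≤ N := by exact_mod_cast le_trans (by norm_num) hN
  exact Real.rpow_le_rpow_of_exponent_le hN1 hab

/-- Rungs are antitone in the shape exponent. -/
theorem thinRung_anti {a b : ℝ} (hab : a ≤ b) (h : ThinRung b) : ThinRung a :=
  fun η hη => thinSlice_anti hab (h η hη)

/-- **FLOOR / WITNESS (F3)**: the `a = 2/7` column is PROVED — read off the tree theorem
`boundedExponentTwoSevenths_proof` (item stmt-MatrixMultiplication-15152) by forgetting the exponent bound. -/
theorem thinRung_twoSevenths : ThinRung (2 / 7 : ℝ) := by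
  obtain ⟨ℓ, hℓ⟩ := boundedExponentTwoSevenths_proof
  intro η hη
  obtain ⟨H, i1, i2, L, N, M, A, B, C, -, hS, hc, hN, hM, hP⟩ := hℓ η hη
  exact ⟨H, i1, i2, L, N, M, A, B, C, hS, hc, hN, hM, hP⟩

/-- The proved region of the ladder: every column `a ≤ 2/7`. -/
theorem thinRung_of_le_twoSevenths {a : ℝ} (ha : a ≤ 2 / 7) : ThinRung a :=
  thinRung_anti ha thinRung_twoSevenths

/-- The exponent-bounded strengthening (item stmt-MatrixMultiplication-10596) gives the rung. -/
theorem thinThird_of_boundedExponentThird (h : BoundedExponentThird) : ThinThird := by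
  obtain ⟨ℓ, hℓ⟩ := h
  intro η hη
  obtain ⟨H, i1, i2, L, N, M, A, B, C, -, hS, hc, hN, hM, hP⟩ := hℓ η hη
  exact ⟨H, i1, i2, L, N, M, A, B, C, hS, hc, hN, hM, hP⟩

/-- PAYOFF of the rung: `ω_ℂ(1, 1/3, 1) = 2` (CKSU Thm 5.5 in the tree, `omegaRect_eq_two_of_thinDesigns`). -/
theorem omegaRect_third_of_thinThird (h : ThinThird) : omegaRect ℂ 1 (1 / 3 : ℝ) 1 = 2 :=
  omegaRect_eq_two_of_thinDesigns (by norm_num) h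

/-- PAYOFF of the rung, rank form: `ThinThird → DAlphaOneThird` (stmt-MatrixMultiplication-0606: `R(⟨n, ⌈n^{1/3}⌉, n⟩) =
O(n^{2+ε})`, i.e. `α_ℂ ≥ 1/3`, beyond the laser-method record `0.321334`). -/
theorem dAlphaOneThird_of_thinThird (h : ThinThird) : RectangularAlpha.DAlphaOneThird :=
  fun _ hε => isBigO_of_omegaRect_eq_two (omegaRect_third_of_thinThird h) hε

/-- More generally every column certifies its dual-exponent reading. -/
theorem omegaRect_of_thinRung {a : ℝ} (ha : 0 ≤ a) (h : ThinRung a) : omegaRect ℂ 1 a 1 = 2 :=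
  omegaRect_eq_two_of_thinDesigns ha h

/-! ## The certificate format of the line: trapped tight seeds -/

/-- **Trapped tight seed at shape `a`** — the finite certificate behind the floor proof, made generic.  Data: a finite
abelian base `H₀`; a chart `XA XB XC : Fin G → Finset H₀` with per-symbol TPP; profile maps `p₁ p₂ p₃` into
`Fin r₁, Fin r₂, Fin r₃`, injective as a triple, with image the support `S`; a Farkas functional `(f₁, f₂, f₃)` vanishing on
every symbol, nonnegative on solvable patterns and zero only on patterns whose profile triple lies in `S` (TRAPPING); tight
labels `α β γ` (injective, `α, β` bounded by `b`, summing to zero on `S`); a base type `Q` supported on `S` with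
distribution `P = Q / |Q|`; the base block `⟨NA, NB, NC⟩`, `NX = ∏ₓ |XX x|^{Q (profile x)}`, has `NC = NA ≥ 2`,
`NA^a ≤ NB`, and ENTROPY TIGHTNESS `|H₀|^{|Q|} ≤ NA² · 2^{|Q| · (min_m H(P_m) - Γ_S(P))}` with the tree's functionals
(`shannonEntropy`, `marginalDistᵢ`, `maxEntropyPenalty`).  The null-offset chart over `ℤ/9` with `Q = (7,2,7,2)` is such a
seed at `a = 2/7` (Theorems/RectangularThmB/Negative/NullChart*.lean). -/
def TrappedTightSeed (a : ℝ) : Prop :=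
  ∃ (H₀ : Type) (_ : AddCommGroup H₀) (_ : Fintype H₀) (_ : DecidableEq H₀)
    (G r₁ r₂ r₃ k b : ℕ) (XA XB XC : Fin G → Finset H₀)
    (p₁ : Fin G → Fin r₁) (p₂ : Fin G → Fin r₂) (p₃ : Fin G → Fin r₃)
    (f₁ f₂ f₃ : Fin G → ℤ)
    (α : Fin r₁ → Fin k → ℤ) (β : Fin r₂ → Fin k → ℤ) (γ : Fin r₃ → Fin k → ℤ)
    (S : Finset (Fin r₁ × Fin r₂ × Fin r₃)) (Q : Fin r₁ × Fin r₂ × Fin r₃ → ℕ)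
    (P : Fin r₁ × Fin r₂ × Fin r₃ → ℝ),
    -- the chart: per-symbol TPP; symbols are their profile triples; `S` = the set of symbol profiles
    (∀ x, SymbolTPP (XA x) (XB x) (XC x)) ∧
    (Function.Injective fun x => (p₁ x, p₂ x, p₃ x)) ∧
    (∀ x, (p₁ x, p₂ x, p₃ x) ∈ S) ∧ (∀ s ∈ S, ∃ x, (p₁ x, p₂ x, p₃ x) = s) ∧
    -- trapping by a Farkas functional vanishing on every symbol
    (∀ x, f₁ x + f₂ x + f₃ x = 0) ∧
    (∀ x y z, ChartSolvable XA XB XC x y z →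
      0 ≤ f₁ x + f₂ y + f₃ z ∧ (f₁ x + f₂ y + f₃ z = 0 → (p₁ x, p₂ y, p₃ z) ∈ S)) ∧
    -- tight bounded injective labels
    Function.Injective α ∧ Function.Injective β ∧ Function.Injective γ ∧
    (∀ i ρ, |α i ρ| ≤ b) ∧ (∀ j ρ, |β j ρ| ≤ b) ∧
    (∀ s ∈ S, ∀ ρ, α s.1 ρ + β s.2.1 ρ + γ s.2.2 ρ = 0) ∧
    -- the base type `Q` on `S` and its distribution `P = Q / |Q|`
    (∀ s, s ∉ S → Q s = 0) ∧ 0 < ∑ s, Q s ∧ (∀ s, P s = (Q s : ℝ) / ((∑ s, Q s : ℕ) : ℝ)) ∧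
    -- shape and size of the base block `⟨NA, NB, NC⟩`
    (∏ x, (XC x).card ^ Q (p₁ x, p₂ x, p₃ x)) = (∏ x, (XA x).card ^ Q (p₁ x, p₂ x, p₃ x)) ∧
    2 ≤ (∏ x, (XA x).card ^ Q (p₁ x, p₂ x, p₃ x)) ∧
    (((∏ x, (XA x).card ^ Q (p₁ x, p₂ x, p₃ x) : ℕ) : ℝ)) ^ a ≤
      ((∏ x, (XB x).card ^ Q (p₁ x, p₂ x, p₃ x) : ℕ) : ℝ) ∧
    -- entropy tightness: `|H₀|^{|Q|} ≤ NA² · 2^{|Q| (min_m H(P_m) - Γ_S(P))}`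
    (Fintype.card H₀ : ℝ) ^ (∑ s, Q s) ≤
      (((∏ x, (XA x).card ^ Q (p₁ x, p₂ x, p₃ x) : ℕ) : ℝ)) ^ 2 *
        (2 : ℝ) ^ (((∑ s, Q s : ℕ) : ℝ) *
          (min (shannonEntropy (marginalDist₁ P))
              (min (shannonEntropy (marginalDist₂ P)) (shannonEntropy (marginalDist₃ P))) -
            maxEntropyPenalty S P))

/-! ## Registered stubs -/

namespace Stmt

/-- [stub, LOAD-BEARING, open] a trapped tight seed at shape exponent `1/3` exists. -/
def stub_trappedSeedThird : Prop := TrappedTightSeed (1 / 3 : ℝ)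

/-- [stub, known method, unformalised] the seed compiler: a trapped tight seed at shape `a ≥ 0` generates the whole
`a`-column (hashing on the `m`-fold type `m • Q`, trapping ⇒ local chart-USP, CKSU Thm 37, growth). -/
def stub_trappedSeedCompiler : Prop := ∀ a : ℝ, 0 ≤ a → TrappedTightSeed a → ThinRung a

end Stmt

/-- **stub** (load-bearing): a trapped tight seed at `a = 1/3`.  Why plausibly true: the format is inhabited at `2/7`
(null-offset chart over `ℤ/9`), and the located deficit at `ℤ/8` (`0.0613` bits) is a property of BINARY profile legs,
not of the format — charts with `≥ 3` profile classes on legs 1, 2 (more symbols / other bases `H₀`, e.g. `ℤ/8`, `ℤ/3 × ℤ/3`,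
`ℤ/16`, products) are unsearched.  Why it might fail: the pair lemma (census N4(a)) and Thm B at small exponent constrain
trapped charts; every benchmark chart searched so far sits at `a ≤ 0.2929`.  Size: M (search) + M (certificate check). -/
theorem stub_trappedSeedThird : Stmt.stub_trappedSeedThird := by
  sorry

/-- **stub** (compiler): `TrappedTightSeed a → ThinRung a` for `a ≥ 0`.  TRUE by the floor's pipeline
(`twoSevenths_thin_family`, ~170 lines for one chart) run generically: `exists_free_diagonal_jointType_card` on the type
`m • Q` (`P` unchanged), rows read through the profile bijection, Farkas sum `= Σₓ countₓ (f₁+f₂+f₃)(x) = 0` forces every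
coordinate's Farkas value to `0`, hence every profile triple into `S`, hence (free diagonal) equal rows ⇒ `IsLocalChartUSP`;
`stub_chartSTPP` ⇒ `IsSTPP`; cards `NA^m, NB^m, NA^m`; `|H₀|^{dm} ≤ NA^{2m} 2^{dm·rate} ≤ NA^{2m} |Δ| · loss`, and the
subexponential `loss < NA^{mη}` for `m ≥ m₀(η)` (`NA ≥ 2`).  Size: L (generic growth lemma + type bookkeeping). -/
theorem stub_trappedSeedCompiler : Stmt.stub_trappedSeedCompiler := by
  sorry

/-- **Composition** (kernel-checked): the two stubs give the rung `ThinThird` BY NAME. -/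
theorem ThinThird_of : Stmt.stub_trappedSeedCompiler → Stmt.stub_trappedSeedThird → ThinThird :=
  fun hC hS => hC (1 / 3 : ℝ) (by norm_num) hS

/-- The rung from the registered stubs. -/
theorem ThinThird_proof : ThinThird := ThinThird_of stub_trappedSeedCompiler stub_trappedSeedThird

/-- LADDER: the rung sits between the floor and the crux — `ThinPackings → ThinThird`, `ThinThird → ThinRung a` for all
`a ≤ 1/3` (in particular the floor region), and `ThinThird → DAlphaOneThird`. -/
theorem ladder_summary :
    (ThinPackings → ThinThird) ∧ (∀ a : ℝ, a ≤ 1 / 3 → ThinThird → ThinRung a) ∧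
    (BoundedExponentThird → ThinThird) ∧ (ThinThird → RectangularAlpha.DAlphaOneThird) ∧ ThinRung (2 / 7 : ℝ) :=
  ⟨thinThird_of_thinPackings, fun _ ha h => thinRung_anti ha h, thinThird_of_boundedExponentThird,
    dAlphaOneThird_of_thinThird, thinRung_twoSevenths⟩

end Summit.MatrixMultiplication.MatrixMultiplication.Cruxes.ThinPackings.ThinThirdRung

end
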